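import Summits.CriticalPhenomena.PercolationContinuityZ3.Theorems.Transplant.FKConnectivityAllQWheelParams
import Summits.CriticalPhenomena.PercolationContinuityZ3.Theorems.Transplant.FKConnectivityAllQWheelClusters
import HarnessLib

/-!
# Connectivity correlation inequalities for `φ_{w,q}`, every `q > 0` — LEMMA T: the CYCLIC TRANSFER FORMULA for the partition function of an
# apex-over-cycle weighted graph, `Z_w = q·[Tr ∏ E(r_j)S(p_j) − (2−q)·∏ r_j·∏ (1−p_j)]`

Support file (`--supports stmt-CriticalPhenomena-4575`), FK sub-lane `prim-bschramm-fk-3` (gen 8) of the post-continuity programme; builds on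
p205010 (kernel theorem, internal audit signed; external expert review pending).  No definitions, no named facts, no sorries; standard axioms.
Blueprint: bschramm/prim-bschramm-fk-3/WHEELS-HUB-NC.md §2.

**`FK.Wheel.rcPartitionFunctionW_eq_transferT`** — for a finite vertex type `V` with `Fintype.card V = n + 1`, `n ≥ 3`, a hub `x`, pairwise distinct rim
vertices `v 0, …, v (n−1)` (`≠ x`), and every weight vector `w` supported on the wheel pairs (spokes `s(x, v j)`, rim pairs `s(v j, v (j+1 mod n))`):
`rcPartitionFunctionW w q ∅ = FK.Wheel.transferT q w x v n`, i.e. `Z_w = q·(Tr seg − (2−q)·∏_j rOf w j·∏_j (1 − pOf w j))` with the 2×2 transfer matrices of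
`…AllQWheelTransfer.lean`.  PROOF: both sides are affine in every wheel pair (`rcPartitionFunctionW_affine`, fk-2; `transferT_affine`,
`…AllQWheelParams.lean`), so by RIGID INTERPOLATION (`FK.eq_of_affine_of_rigid`, `…AllQRigidInterpolation.lean`) it suffices to treat weight vectors with
all parameters in `{0,1}`; there `Z_w = q^{k(ω_w)}` (`rcPartitionFunctionW_rigid_eq_pow`), `ω_w` is the vertex-by-vertex configuration `conf` of
`…AllQWheelAutomaton.lean` (`setOf_eq_conf`), whose cluster count is computed by the rim automaton (`clusterCount_conf_of_cut / _of_no_cut`,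
`…AllQWheelClusters.lean`) after ROTATING the rim so that a closed rim pair comes last (`conf_rotate`, `seg_rotate_params`, trace cyclicity
`trace_seg_rotate`), and the trace of the rigid word is the same automaton count (`trace_seg_rigid_of_cut / _of_no_cut`, `…AllQWheelWord.lean`).
[cite: Grimmett2006, §1.2 eq. (1.1), §1.4 eq. (1.20) (pp. 4, 15); Thm. (3.1)(a) (p. 37)]
-/

noncomputable section

namespace Summit.CriticalPhenomena.PercolationContinuityZ3.Theorems

namespace FK

namespace Wheel

open Matrix WheelTM Literature.Probability.LatticeModels Literature.Probability.Percolation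
open scoped Classical

variable {V : Type*} [Fintype V] [DecidableEq V]

/-! ### Periodicity of the parameters -/

omit [Fintype V] [DecidableEq V] in
/-- Spoke parameters are `n`-periodic. [folklore] -/
theorem pOf_mod (w : Sym2 V → unitInterval) (x : V) (v : ℕ → V) (n j : ℕ) : pOf w x v n (j % n) = pOf w x v n j := by
  unfold pOf; rw [spokePair_mod]

omit [Fintype V] [DecidableEq V] in
/-- Rim parameters are `n`-periodic. [folklore] -/
theorem rOf_mod (w : Sym2 V → unitInterval) (v : ℕ → V) (n j : ℕ) : rOf w v n (j % n) = rOf w v n j := by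
  unfold rOf; rw [rimPair_mod]

/-! ### Rotating the rim labelling -/

section Rotate

variable (w : Sym2 V → unitInterval) (x : V) (v : ℕ → V) (n a : ℕ)

omit [Fintype V] [DecidableEq V] in
/-- A modular arithmetic identity: `(j % n + a) % n = (j + a) % n`. [folklore] -/
theorem mod_add_mod' (j : ℕ) : (j % n + a) % n = (j + a) % n := Nat.mod_add_mod j n a

omit [Fintype V] [DecidableEq V] in
/-- Spoke parameters of the rotated labelling `v' j = v ((j + a) % n)`. [folklore] -/
theorem pOf_rotate (j : ℕ) : pOf w x (fun i => v ((i + a) % n)) n j = pOf w x v n (j + a) := by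
  unfold pOf spokePair
  simp only []
  rw [Nat.mod_add_mod]

omit [Fintype V] [DecidableEq V] in
/-- Rim parameters of the rotated labelling. [folklore] -/
theorem rOf_rotate (j : ℕ) : rOf w (fun i => v ((i + a) % n)) n j = rOf w v n (j + a) := by
  unfold rOf rimPair
  simp only []
  rw [Nat.mod_add_mod, Nat.mod_add_mod, Nat.add_right_comm]

omit [Fintype V] [DecidableEq V] in
/-- Letters of the rotated labelling are the shifted letters. [folklore] -/
theorem letter_rotate (q : ℝ) (j : ℕ) :
    letter q (pOf w x (fun i => v ((i + a) % n)) n) (rOf w (fun i => v ((i + a) % n)) n) n j =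
      letter q (pOf w x v n) (rOf w v n) n (j + a) := by
  unfold letter
  rw [pOf_rotate, rOf_rotate, ← pOf_mod w x v n (j % n + a), ← rOf_mod w v n (j % n + a), Nat.mod_add_mod,
    pOf_mod, rOf_mod, ← pOf_mod w x v n (j + a), ← rOf_mod w v n (j + a)]

omit [Fintype V] [DecidableEq V] in
/-- **Segments of the rotated labelling are the shifted segments**: `seg' 0 ℓ = seg a ℓ`. [folklore] -/
theorem seg_rotate_params (q : ℝ) (ℓ : ℕ) :
    seg q (pOf w x (fun i => v ((i + a) % n)) n) (rOf w (fun i => v ((i + a) % n)) n) n 0 ℓ = seg q (pOf w x v n) (rOf w v n) n a ℓ := by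
  induction ℓ with
  | zero => rfl
  | succ ℓ ih => rw [seg_succ, seg_succ, ih, letter_rotate, Nat.zero_add, Nat.add_comm ℓ a]

omit [Fintype V] in
/-- **The configuration is labelling-independent**: for `n`-periodic Boolean data, the vertex-by-vertex configuration of the rotated labelling (with
rotated data) is the same finset of pairs (`a ≤ n`, `1 ≤ n`). [folklore] -/
theorem conf_rotate (σ τ : ℕ → Bool) (hσ : ∀ j, σ (j % n) = σ j) (hτ : ∀ j, τ (j % n) = τ j) (hn : 1 ≤ n) (ha : a ≤ n) :
    conf (fun j => σ (j + a)) (fun j => τ (j + a)) x (fun i => v ((i + a) % n)) n n = conf σ τ x v n n := by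
  ext e
  rw [mem_conf_iff, mem_conf_iff]
  have hnpos : 0 < n := hn
  -- the bijection `j ↦ (j + a) % n` of `[0, n)` and its inverse `m ↦ (m + n − a) % n`
  have hinv : ∀ m, m < n → ((m + n - a) % n + a) % n = m := by
    intro m hm
    rw [Nat.mod_add_mod, show m + n - a + a = m + n by omega, Nat.add_mod_right, Nat.mod_eq_of_lt hm]
  constructor
  · rintro (⟨j, hj, hs, he⟩ | ⟨j, hj, ht, he⟩)
    · refine Or.inl ⟨(j + a) % n, Nat.mod_lt _ hnpos, by rw [hσ]; exact hs, ?_⟩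
      rw [he]
    · refine Or.inr ⟨(j + a) % n, Nat.mod_lt _ hnpos, by rw [hτ]; exact ht, ?_⟩
      rw [he, Nat.mod_add_mod, Nat.mod_add_mod, Nat.add_right_comm]
  · rintro (⟨m, hm, hs, he⟩ | ⟨m, hm, ht, he⟩)
    · refine Or.inl ⟨(m + n - a) % n, Nat.mod_lt _ hnpos, ?_, ?_⟩
      · rw [← hσ, hinv m hm]; exact hs
      · rw [he, hinv m hm]
    · refine Or.inr ⟨(m + n - a) % n, Nat.mod_lt _ hnpos, ?_, ?_⟩
      · rw [← hτ, hinv m hm]; exact ht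
      · rw [he, hinv m hm, Nat.mod_add_mod, Nat.add_assoc, Nat.mod_add_mod, show m + n - a + (1 + a) = m + 1 + n by omega,
          Nat.add_mod_right]

end Rotate

/-! ### The rigid case -/

section Rigid

variable {x : V} {v : ℕ → V} {n : ℕ}
variable (hn : 3 ≤ n) (hinj : ∀ j k, j < n → k < n → v j = v k → j = k) (hx : ∀ j, j < n → v j ≠ x) (hcard : Fintype.card V = n + 1)
include hn hinj hx hcard

omit [Fintype V] hn hinj hx hcard in
/-- At a rigid weight vector supported on the wheel pairs, the open configuration `{e | w e = 1}` is the vertex-by-vertex configuration `conf σ τ`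
with `σ j = [pOf w j = 1]`, `τ j = [rOf w j = 1]`. [folklore] -/
theorem setOf_eq_conf (w : Sym2 V → unitInterval) (hsupp : ∀ e, e ∉ wheelPairs x v n → w e = 0)
    (σ τ : ℕ → Bool) (hσ : ∀ j, (σ j = true ↔ pOf w x v n j = 1)) (hτ : ∀ j, (τ j = true ↔ rOf w v n j = 1)) :
    ({e | ((w e : unitInterval) : ℝ) = 1} : Set (Sym2 V)) = ↑(conf σ τ x v n n) := by
  ext e
  rw [Set.mem_setOf_eq, Finset.mem_coe, mem_conf_iff]
  constructor
  · intro h1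
    have hne : w e ≠ 0 := fun h0 => by rw [h0] at h1; norm_num at h1
    have hmem : e ∈ wheelPairs x v n := by by_contra hc; exact hne (hsupp e hc)
    rcases (mem_wheelPairs_iff e).1 hmem with ⟨j, hj, rfl⟩ | ⟨j, hj, rfl⟩
    · refine Or.inl ⟨j, hj, (hσ j).2 h1, ?_⟩
      unfold spokePair; rw [Nat.mod_eq_of_lt hj]
    · refine Or.inr ⟨j, hj, (hτ j).2 h1, ?_⟩
      unfold rimPair; rw [Nat.mod_eq_of_lt hj]
  · rintro (⟨j, hj, hs, rfl⟩ | ⟨j, hj, ht, rfl⟩)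
    · have := (hσ j).1 hs
      unfold pOf spokePair at this; rwa [Nat.mod_eq_of_lt hj] at this
    · have := (hτ j).1 ht
      unfold rOf rimPair at this; rwa [Nat.mod_eq_of_lt hj] at this

/-- **The rigid case of LEMMA T**: at a weight vector supported on the wheel pairs with all parameters in `{0,1}`,
`Z_w = transferT q w` (`= q^{k(ω_w)}`). (transcription of bschramm/prim-bschramm-fk-3/WHEELS-HUB-NC.md §2) -/
theorem rcPartitionFunctionW_eq_transferT_rigid (q : ℝ) (w : Sym2 V → unitInterval) (hsupp : ∀ e, e ∉ wheelPairs x v n → w e = 0)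
    (hrig : ∀ e ∈ wheelPairs x v n, ((w e : unitInterval) : ℝ) = 0 ∨ ((w e : unitInterval) : ℝ) = 1) :
    rcPartitionFunctionW w q ∅ = transferT q w x v n := by
  have hn1 : 1 ≤ n := by omega
  -- rigidity everywhere
  have hR : ∀ e : Sym2 V, ((w e : unitInterval) : ℝ) = 0 ∨ ((w e : unitInterval) : ℝ) = 1 := by
    intro e
    by_cases he : e ∈ wheelPairs x v n
    · exact hrig e he
    · left; rw [hsupp e he]; rfl
  -- Boolean data
  set σ : ℕ → Bool := fun j => decide (pOf w x v n j = 1) with hσdef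
  set τ : ℕ → Bool := fun j => decide (rOf w v n j = 1) with hτdef
  have hσ : ∀ j, (σ j = true ↔ pOf w x v n j = 1) := fun j => by simp [hσdef]
  have hτ : ∀ j, (τ j = true ↔ rOf w v n j = 1) := fun j => by simp [hτdef]
  have hσper : ∀ j, σ (j % n) = σ j := fun j => by simp only [hσdef, pOf_mod]
  have hτper : ∀ j, τ (j % n) = τ j := fun j => by simp only [hτdef, rOf_mod]
  have hp : ∀ j, pOf w x v n j = if σ j = true then 1 else 0 := by
    intro j
    rcases hR (spokePair x v n j) with h0 | h1
    · have : ¬ σ j = true := fun h => by have := (hσ j).1 h; unfold pOf at this; rw [h0] at this; norm_num at this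
      rw [if_neg this]; exact h0
    · rw [if_pos ((hσ j).2 h1)]; exact h1
  have hr : ∀ j, rOf w v n j = if τ j = true then 1 else 0 := by
    intro j
    rcases hR (rimPair v n j) with h0 | h1
    · have : ¬ τ j = true := fun h => by have := (hτ j).1 h; unfold rOf at this; rw [h0] at this; norm_num at this
      rw [if_neg this]; exact h0
    · rw [if_pos ((hτ j).2 h1)]; exact h1
  -- the left-hand side: `q^{k(conf)}`
  rw [rcPartitionFunctionW_rigid_eq_pow w q hR, setOf_eq_conf w hsupp σ τ hσ hτ]
  unfold transferT
  by_cases hall : ∀ j, j < n → τ j = true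
  · -- no cut: all rim pairs open
    rw [clusterCount_conf_of_no_cut hn1 hinj hx hcard (by omega) hall, trace_seg_rigid_of_no_cut q _ _ n hp hr hall]
    have hRprod : ∏ j ∈ Finset.range n, rOf w v n j = 1 :=
      Finset.prod_eq_one fun j hj => by rw [hr j, if_pos (hall j (Finset.mem_range.1 hj))]
    rw [hRprod]
    by_cases hex : ∃ j, j < n ∧ σ j = true
    · obtain ⟨j₀, hj₀, hs₀⟩ := hex
      have hPprod : ∏ j ∈ Finset.range n, (1 - pOf w x v n j) = 0 :=
        Finset.prod_eq_zero (Finset.mem_range.2 hj₀) (by rw [hp j₀, if_pos hs₀]; ring)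
      rw [hPprod, if_pos ⟨j₀, hj₀, hs₀⟩, if_pos ⟨j₀, hj₀, hs₀⟩]
      ring
    · have hPprod : ∏ j ∈ Finset.range n, (1 - pOf w x v n j) = 1 :=
        Finset.prod_eq_one fun j hj => by
          rw [hp j, if_neg (fun h => hex ⟨j, Finset.mem_range.1 hj, h⟩)]; ring
      rw [hPprod, if_neg hex, if_neg hex]
      ring
  · -- a cut: rotate it to the last position
    push Not at hall
    obtain ⟨j₀, hj₀, hcut⟩ := hall
    have hcut' : τ j₀ = false := by simpa using hcut
    set a := j₀ + 1 with ha
    have han : a ≤ n := by omega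
    set v' : ℕ → V := fun i => v ((i + a) % n) with hv'
    set σ' : ℕ → Bool := fun j => σ (j + a) with hσ'
    set τ' : ℕ → Bool := fun j => τ (j + a) with hτ'
    have hinj' : ∀ j k, j < n → k < n → v' j = v' k → j = k := by
      intro j k hj hk h
      have h1 := hinj _ _ (Nat.mod_lt _ (by omega)) (Nat.mod_lt _ (by omega)) h
      -- `(j + a) % n = (k + a) % n` with `j, k < n`
      have := Nat.ModEq.add_right_cancel' a (show (j + a) % n = (k + a) % n from h1)
      rw [Nat.ModEq, Nat.mod_eq_of_lt hj, Nat.mod_eq_of_lt hk] at this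
      exact this
    have hx' : ∀ j, j < n → v' j ≠ x := fun j _ => hx _ (Nat.mod_lt _ (by omega))
    have hcutlast : τ' (n - 1) = false := by
      show τ (n - 1 + a) = false
      rw [← hτper, show n - 1 + a = j₀ + n by omega, Nat.add_mod_right, hτper, hcut']
    -- cluster count via the rotated labelling
    have hconf : conf σ τ x v n n = conf σ' τ' x v' n n := (conf_rotate x v n a σ τ hσper hτper hn1 han).symm
    rw [hconf, clusterCount_conf_of_cut hn1 hinj' hx' hcard hcutlast]
    -- trace via rotation and the rigid word of the rotated labelling
    have hp' : ∀ j, pOf w x v' n j = if σ' j = true then 1 else 0 := fun j => by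
      show pOf w x (fun i => v ((i + a) % n)) n j = _; rw [pOf_rotate, hp]
    have hr' : ∀ j, rOf w v' n j = if τ' j = true then 1 else 0 := fun j => by
      show rOf w (fun i => v ((i + a) % n)) n j = _; rw [rOf_rotate, hr]
    have htr : (seg q (pOf w x v n) (rOf w v n) n 0 n).trace = q ^ (run σ' τ' n).1 := by
      rw [← trace_seg_rotate q _ _ n a han, ← seg_rotate_params w x v n a q n]
      exact trace_seg_rigid_of_cut q _ _ n hp' hr' hn1 hcutlast
    have hRprod : ∏ j ∈ Finset.range n, rOf w v n j = 0 :=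
      Finset.prod_eq_zero (Finset.mem_range.2 hj₀) (by rw [hr j₀, hcut']; simp)
    rw [htr, hRprod]
    ring

end Rigid

/-! ### LEMMA T -/

/-- **LEMMA T — the cyclic transfer formula.**  For a hub `x`, pairwise distinct rim vertices `v 0, …, v (n−1)` (`≠ x`, `n ≥ 3`,
`Fintype.card V = n + 1`) and every weight vector `w` supported on the wheel pairs,
`rcPartitionFunctionW w q ∅ = transferT q w x v n = q·(Tr ∏_j E(r_j)S(p_j) − (2−q)·∏_j r_j·∏_j (1 − p_j))`.
(transcription of bschramm/prim-bschramm-fk-3/WHEELS-HUB-NC.md §2, LEMMA T) -/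
theorem rcPartitionFunctionW_eq_transferT {x : V} {v : ℕ → V} {n : ℕ} (hn : 3 ≤ n)
    (hinj : ∀ j k, j < n → k < n → v j = v k → j = k) (hx : ∀ j, j < n → v j ≠ x) (hcard : Fintype.card V = n + 1)
    (q : ℝ) (w : Sym2 V → unitInterval) (hsupp : ∀ e, e ∉ wheelPairs x v n → w e = 0) :
    rcPartitionFunctionW w q ∅ = transferT q w x v n :=
  eq_of_affine_of_rigid (wheelPairs x v n) (fun u => rcPartitionFunctionW u q ∅) (fun u => transferT q u x v n)
    (fun u _ e _ => rcPartitionFunctionW_affine u q e)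
    (fun u _ _ he => transferT_affine hn hinj hx q u he)
    (fun u hu hr => rcPartitionFunctionW_eq_transferT_rigid hn hinj hx hcard q u hu hr) w hsupp

end Wheel

end FK

end Summit.CriticalPhenomena.PercolationContinuityZ3.Theorems

end
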